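import Literature.Probability.RandomPlanarGeometry.HexSAWBrickWallStripBridges
import Literature.Probability.RandomPlanarGeometry.HexSAWBrickWallBridgeEnvelope
import Literature.Probability.RandomPlanarGeometry.HexSAWHammersleyWelshLog
import HarnessLib

/-!
# Locality of the connective constant of the honeycomb lattice in strips, with an explicit rate:
# `0 ≤ log μ_ℍ − log μ(S_T) ≤ 30/√T`

Topic `Literature/Probability/RandomPlanarGeometry` (continues `HexSAWBrickWallStrip.lean` — the row strips
`S_T = ℤ × {0,…,T}` of the brick wall = honeycomb lattice, `HexBW.stripConnectiveConstant T = μ(S_T)`,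
`μ(S_T) ≤ μ_ℍ`, monotone in `T` — and `HexSAWBrickWallStripBridges.lean` — for odd `N` a class size `B` with
`b_N(ℍ) ≤ (2N+1) B` and `B^{2j} ≤ c_{2jN}(S_{4N})`).  Source: N. Madras, G. Slade, *The Self-Avoiding Walk*
(1993), Theorem 8.2.1, eq. (8.2.12), p. 269: "`lim_{T→∞} μ(R[k,T]) = μ`" (for the tubes and slabs of `ℤ^d`;
the tree has it with the rate `(4 log μ + 8d + 32)/√T`, `Zd.log_sub_log_tubeConnectiveConstant_le`, and
`45/√T` for the planar strip).  This file proves the honeycomb version WITH AN EXPLICIT RATE, by the same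
scheme: the counting inequality of `HexSAWBrickWallStripBridges`, the Hammersley–Welsh bound of the tree in the
form `c_n(ℍ) ≤ e^{6√n} b_{n+1}(ℍ)` (`HexBW.hexSawCount_le_exp_mul_bridgeCount`, Madras–Slade (3.1.9)),
`μ_ℍ^n ≤ c_n(ℍ)`, and `μ_ℍ ≤ 37/20` (`hexConnectiveConstant_le`, from `μ_ℍ = √(2+√2)`).

## Main statements (namespace `Literature.Probability.RandomPlanarGeometry.SAW.HexBW`, all PROVED)

* `rpow_le_stripConnectiveConstant` — `B^j ≤ c_{jM}(S_T)` for all `j` gives `B^{1/M} ≤ μ(S_T)`;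
* `log_sub_log_stripConnectiveConstant_four_mul_le` — for ODD `N`:
  `log μ_ℍ − log μ(S_{4N}) ≤ (log μ_ℍ + 6√N + log(2N+1))/N`;
* **`log_sub_log_stripConnectiveConstant_le`** — for every `T ≥ 1`:
  `0 ≤ log μ_ℍ − log μ(S_T) ≤ 30/√T`;
* `exists_log_sub_log_stripConnectiveConstant_le` (the same with `∃ C`), `mul_exp_neg_le_stripConnectiveConstant`,
  `sub_stripConnectiveConstant_le` (`0 ≤ μ_ℍ − μ(S_T) ≤ 56/√T`), and
  **`tendsto_stripConnectiveConstant`** — `μ(S_T) → μ_ℍ` (locality, (8.2.12) on `ℍ`), `iSup_stripConnectiveConstant`;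
* **`log_sub_log_stripConnectiveConstant_le_eventually`** — for every `η > 0`, eventually
  `log μ_ℍ − log μ(S_T) ≤ (12 + η)/√T` (the asymptotic constant `2 · 6` of the proof as a statement).

Remarks. (i) The asymptotic constant of the proof is `12` (`= 2 · 6`, twice the Hammersley–Welsh constant,
from `N ≈ T/4`); `30` absorbs the small widths and the parity bookkeeping (`N` odd, `4N ≤ T ≤ 11N`).
(ii) The bound is a consolidation-grade statement: numerically it is vacuous below `T ≈ 2400`
(`log μ_ℍ = 0.6158`), and the lane's numerics of record for honeycomb strips (P-HEXW′, Duminil-Copin–Smirnov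
frame; the row strip `S_T` IS the Duminil-Copin–Smirnov strip with `T + 1` strips of hexagons — levels `0, …, 2T+1`
under the rotated isomorphism `HexBW.rowIso : brickWallGraph ≃g hvGraph`, `HexBW.inStrip_iff_lev_rowIso` of
`HexSAWBrickWallStripDictionary.lean` — so the numerics' index is `T' = T + 1`) indicate the true order
`(μ_ℍ − μ_{T'}) ≍ T'^{-4/3}`; the `√T`-rate is the artefact of the Hammersley–Welsh lower envelope.

Printed status (lane «pcv-sawmu», route R90 «HEX-STRIP-LOCALITY-RATE»; literature cell lit-1 gen 9,
2026-08-22T23:32:09Z, both corpora queried).  The printed statements are the `ℤ^d` LIMIT — Madras–Slade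
Theorem 8.2.1 (8.2.12) "`lim_{T→∞} μ(R[k,T]) = μ`", p. 269 (after Hammersley–Whittington 1985, Notes §8.5), whose
proof ((8.2.14): "every `s`-step bridge … must lie entirely in `R[k,2s]`", so `μ(R[k,2s]) ≥ b_s(0)^{1/s}`) gives a
rate only implicitly once combined with the Hammersley–Welsh envelope Corollary 3.1.6 (3.1.9), p. 61 — and
Grimmett–Li's qualitative locality theorem for connective constants of transitive graphs with height functions
[cite: GrimmettLi2018Locality]; for honeycomb strips the qualitative LIMIT `μ(S_T) → μ_ℍ` and the STRICT monotonicity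
in `T` are printed (Beaton–Bousquet-Mélou–de Gier–Duminil-Copin–Guttmann 2014, Proposition 7 at `y = 1`,
arXiv:1109.0358 PDF p. 11 — the held LaTeX text's chunk 8; Beaton 2014, §3.2, Proposition 9, arXiv:1210.0274v3 p. 15,
for the rotated strips; proofs by adaptation of Janse van Rensburg–Orlandini–Whittington 2006), a RATE is not printed
for any lattice, and the STRICT inequality `μ(S_T) < μ(S_{T+1})` is NOT proved in this file (only
`stripConnectiveConstant_mono`) (label correction of record, lit-1 g10, 2026-08-23; Duminil-Copin–Smirnov
work IN the strips `S_T` [cite: DuminilCopinSmirnov2012, §3 (strips S_T)]).  This file is Madras–Slade's proof of (8.2.12) made quantitative on `ℍ`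
(consolidation with a rate; the tree twins for `ℤ^d`/`ℤ²` are `SAWTubeLocality.lean`).
-/

noncomputable section

open Filter Topology Finset Literature.Probability.LatticeModels Literature.Probability.Percolation SimpleGraph

namespace Literature.Probability.RandomPlanarGeometry.SAW.HexBW

/-! ### The rate at width `4N`, `N` odd -/

/-- From `B^j ≤ c_{jM}(S_T)` for all `j` (`M ≥ 1`): `B^{1/M} ≤ μ(S_T)`, by `c_n(S_T)^{1/n} → μ(S_T)` along
`n = jM`. [cite: MadrasSlade1993, §8.2, proof of Theorem 8.2.1] -/
theorem rpow_le_stripConnectiveConstant {T M B : ℕ} (hM : 1 ≤ M)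
    (h : ∀ j : ℕ, B ^ j ≤ stripCount T (j * M)) :
    (B : ℝ) ^ (1 / (M : ℝ)) ≤ stripConnectiveConstant T := by
  have hsub : Tendsto (fun j : ℕ => j * M) atTop atTop := tendsto_id.atTop_mul_const' (by omega)
  have hlim := (tendsto_stripCount_rpow T).comp hsub
  refine ge_of_tendsto hlim ?_
  filter_upwards [eventually_ge_atTop 1] with j hj
  have hjM : (j * M : ℕ) ≠ 0 := Nat.mul_ne_zero (by omega) (by omega)
  have hB : (0 : ℝ) ≤ B := Nat.cast_nonneg _
  rw [Function.comp_apply]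
  have h1 : ((B : ℝ) ^ j) ^ (1 / ((j * M : ℕ) : ℝ)) = (B : ℝ) ^ (1 / (M : ℝ)) := by
    rw [← Real.rpow_natCast, ← Real.rpow_mul hB]
    congr 1
    have hj' : (j : ℝ) ≠ 0 := by exact_mod_cast (show j ≠ 0 by omega)
    push_cast
    field_simp
  rw [← h1]
  exact Real.rpow_le_rpow (pow_nonneg hB _) (by exact_mod_cast h j) (by positivity)

/-- **The rate at width `4N` for odd `N`**: `log μ_ℍ − log μ(S_{4N}) ≤ (log μ_ℍ + 6√N + log(2N+1))/N`.
Ingredients: `μ(S_{4N}) ≥ B^{1/N}`, `b_N(ℍ) ≤ (2N+1) B` (`exists_pow_le_stripCount`) and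
`μ_ℍ^{N-1} ≤ c_{N-1}(ℍ) ≤ e^{6√(N-1)} b_N(ℍ)`. [cite: MadrasSlade1993, Theorem 8.2.1, eq. (8.2.12)] -/
theorem log_sub_log_stripConnectiveConstant_four_mul_le {N : ℕ} (hN : Odd N) :
    Real.log hexConnectiveConstant - Real.log (stripConnectiveConstant (4 * N)) ≤
      (Real.log hexConnectiveConstant + 6 * Real.sqrt N + Real.log (2 * N + 1)) / N := by
  obtain ⟨B, hbB, hB⟩ := exists_pow_le_stripCount hN
  set μ := hexConnectiveConstant with hμdef
  have hμ : 0 < μ := hexConnectiveConstant_pos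
  obtain ⟨n, rfl⟩ : ∃ n, N = n + 1 := ⟨N - 1, by obtain ⟨k, hk⟩ := hN; omega⟩
  -- `μ^n ≤ c_n(ℍ) ≤ e^{6√n} b_{n+1} ≤ e^{6√n} (2n+3) B`
  have h1 : μ ^ n ≤ Real.exp (6 * Real.sqrt n) * bridgeCount (n + 1) :=
    (hexConnectiveConstant_pow_le n).trans (hexSawCount_le_exp_mul_bridgeCount n)
  have h2 : (bridgeCount (n + 1) : ℝ) ≤ (2 * ((n : ℝ) + 1) + 1) * B := by exact_mod_cast hbB
  have hBpos : (0 : ℝ) < B := by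
    have hb : (0 : ℝ) < bridgeCount (n + 1) := by exact_mod_cast one_le_bridgeCount (n + 1)
    have hP0 : (0 : ℝ) < 2 * ((n : ℝ) + 1) + 1 := by positivity
    nlinarith [hb, h2, hP0]
  have h3 : μ ^ n ≤ Real.exp (6 * Real.sqrt n) * ((2 * ((n : ℝ) + 1) + 1) * B) :=
    h1.trans (mul_le_mul_of_nonneg_left h2 (Real.exp_nonneg _))
  -- `B^{1/N} ≤ μ(S_{4N})`
  have hn1 : (0 : ℝ) < (n : ℝ) + 1 := by positivity
  have h4 : (B : ℝ) ^ (1 / ((n : ℝ) + 1)) ≤ stripConnectiveConstant (4 * (n + 1)) := by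
    have h := rpow_le_stripConnectiveConstant (T := 4 * (n + 1)) (M := 2 * (n + 1)) (B := B ^ 2) (by omega)
      (fun j => by rw [← pow_mul]; exact hB j)
    have e : ((B ^ 2 : ℕ) : ℝ) ^ (1 / ((2 * (n + 1) : ℕ) : ℝ)) = (B : ℝ) ^ (1 / ((n : ℝ) + 1)) := by
      push_cast
      rw [← Real.rpow_natCast (B : ℝ) 2, ← Real.rpow_mul hBpos.le]
      congr 1
      push_cast
      field_simp
    rwa [e] at h
  -- take logarithms
  have hS : 0 < stripConnectiveConstant (4 * (n + 1)) := stripConnectiveConstant_pos _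
  have hlog4 : Real.log B ≤ ((n : ℝ) + 1) * Real.log (stripConnectiveConstant (4 * (n + 1))) := by
    have h := Real.log_le_log (Real.rpow_pos_of_pos hBpos _) h4
    rw [Real.log_rpow hBpos] at h
    have h' := mul_le_mul_of_nonneg_left h hn1.le
    rwa [← mul_assoc, mul_one_div_cancel hn1.ne', one_mul] at h'
  have hlog3 : (n : ℝ) * Real.log μ ≤ 6 * Real.sqrt n + Real.log (2 * ((n : ℝ) + 1) + 1) + Real.log B := by
    have := Real.log_le_log (pow_pos hμ n) h3
    rw [Real.log_pow, Real.log_mul (by positivity) (by positivity), Real.log_exp,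
      Real.log_mul (by positivity) hBpos.ne'] at this
    linarith
  have hsqrt : Real.sqrt n ≤ Real.sqrt ((n : ℝ) + 1) := Real.sqrt_le_sqrt (by linarith)
  push_cast
  rw [le_div_iff₀ hn1]
  nlinarith [hlog3, hlog4, hsqrt]

/-! ### The rate for every width -/

/-- `log μ_ℍ ≤ 17/20` (from `μ_ℍ ≤ 37/20` and `log x ≤ x − 1`). [cite: DuminilCopinSmirnov2012, Thm 1] -/
private theorem log_hexConnectiveConstant_le : Real.log hexConnectiveConstant ≤ 17 / 20 := by
  have h := Real.log_le_sub_one_of_pos hexConnectiveConstant_pos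
  linarith [hexConnectiveConstant_le.1]

/-- `0 ≤ log μ_ℍ` (`1 ≤ μ(S_0) ≤ μ_ℍ`). [cite: DuminilCopinSmirnov2012, Thm 1] -/
private theorem log_hexConnectiveConstant_nonneg : 0 ≤ Real.log hexConnectiveConstant :=
  Real.log_nonneg ((one_le_stripConnectiveConstant 0).trans (stripConnectiveConstant_le 0))

/-- **Locality of `μ_ℍ` in strips with an explicit rate** (Madras–Slade Theorem 8.2.1 (8.2.12), honeycomb
version, quantified): for every `T ≥ 1`, `0 ≤ log μ_ℍ − log μ(S_T) ≤ 30 / √T`.  Proof: for `T < 4` the left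
side is at most `log μ_ℍ ≤ 17/20`; for `T ≥ 4` take the largest odd `N ≤ T/4` (`4N ≤ T ≤ 11N`), use
monotonicity in the width and the rate at width `4N` with `log μ_ℍ ≤ 17/20`, `log(2N+1) ≤ 2√N`, so that
`(log μ_ℍ + 6√N + log(2N+1))/N ≤ (177/20)/√N ≤ (177/20)√11/√T ≤ 30/√T`.
[cite: MadrasSlade1993, Theorem 8.2.1 (8.2.12) and its proof, (8.2.14) (p. 269); Corollary 3.1.6 (3.1.9) (p. 61)] -/
theorem log_sub_log_stripConnectiveConstant_le {T : ℕ} (hT : 1 ≤ T) :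
    0 ≤ Real.log hexConnectiveConstant - Real.log (stripConnectiveConstant T) ∧
    Real.log hexConnectiveConstant - Real.log (stripConnectiveConstant T) ≤ 30 / Real.sqrt T := by
  set μ := hexConnectiveConstant with hμdef
  have hlogμ : 0 ≤ Real.log μ := log_hexConnectiveConstant_nonneg
  have hlogμ' : Real.log μ ≤ 17 / 20 := log_hexConnectiveConstant_le
  have hTpos : 0 < stripConnectiveConstant T := stripConnectiveConstant_pos T
  have hupper : Real.log (stripConnectiveConstant T) ≤ Real.log μ :=
    Real.log_le_log hTpos (stripConnectiveConstant_le T)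
  have hlower : 0 ≤ Real.log (stripConnectiveConstant T) := Real.log_nonneg (one_le_stripConnectiveConstant T)
  refine ⟨by linarith, ?_⟩
  have hTr : (1 : ℝ) ≤ T := by exact_mod_cast hT
  have hsT : 1 ≤ Real.sqrt T := by rw [Real.le_sqrt' one_pos]; linarith
  have hsT0 : 0 < Real.sqrt T := by linarith
  by_cases h4 : T < 4
  · -- small widths: `log μ − log μ(S_T) ≤ log μ ≤ 17/20 ≤ 30/2 ≤ 30/√T` as `√T ≤ 2`
    have hs2 : Real.sqrt T ≤ 2 := by
      rw [Real.sqrt_le_left (by norm_num)]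
      exact_mod_cast (show T ≤ 4 by omega)
    rw [le_div_iff₀ hsT0]
    nlinarith [hupper, hlower, hs2, hlogμ]
  · -- `T ≥ 4`: `N` = the largest odd number `≤ T/4`: `N ≥ 1`, `4N ≤ T ≤ 11N`
    rw [not_lt] at h4
    set q := T / 4 with hqdef
    set N := q - (1 - q % 2) with hNdef
    have hq1 : 1 ≤ q := by omega
    have hNodd : Odd N := Nat.odd_iff.2 (by omega)
    have hN1 : 1 ≤ N := by omega
    have h4N : 4 * N ≤ T := by omega
    have hT11 : T ≤ 11 * N := by omega
    have hNr : (1 : ℝ) ≤ N := by exact_mod_cast hN1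
    have hmono : stripConnectiveConstant (4 * N) ≤ stripConnectiveConstant T := stripConnectiveConstant_mono h4N
    have hmono' : Real.log (stripConnectiveConstant (4 * N)) ≤ Real.log (stripConnectiveConstant T) :=
      Real.log_le_log (stripConnectiveConstant_pos _) hmono
    have hrate := log_sub_log_stripConnectiveConstant_four_mul_le hNodd
    -- elementary bounds `log N ≤ 2√N − 2`, `log (2N+1) ≤ 2√N`
    have hsN : 1 ≤ Real.sqrt N := by rw [Real.le_sqrt' one_pos]; linarith
    have hlogN : Real.log N ≤ 2 * Real.sqrt N - 2 := by
      have h := Real.log_le_sub_one_of_pos (show 0 < Real.sqrt N by linarith)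
      rw [Real.log_sqrt (by positivity)] at h
      linarith
    have hlog3 : Real.log 3 < 2 := by
      have : Real.log 3 < 3 - 1 := Real.log_lt_sub_one_of_pos (by norm_num) (by norm_num)
      linarith
    have hlog2N : Real.log (2 * N + 1) ≤ 2 * Real.sqrt N := by
      have h1 : Real.log (2 * N + 1) ≤ Real.log (3 * N) := Real.log_le_log (by linarith) (by linarith)
      rw [Real.log_mul (by norm_num) (by linarith)] at h1
      linarith
    -- `√T ≤ √11 √N`, `√11 ≤ 10/3`
    have hs11 : Real.sqrt 11 ≤ 10 / 3 := by
      rw [Real.sqrt_le_left (by norm_num)]; norm_num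
    have hsTN : Real.sqrt T ≤ 10 / 3 * Real.sqrt N := by
      calc Real.sqrt T ≤ Real.sqrt (11 * N) := Real.sqrt_le_sqrt (by exact_mod_cast hT11)
        _ = Real.sqrt 11 * Real.sqrt N := Real.sqrt_mul (by norm_num) _
        _ ≤ 10 / 3 * Real.sqrt N := mul_le_mul_of_nonneg_right hs11 (by linarith)
    have hsN0 : 0 < Real.sqrt N := by linarith
    have hNsq : (N : ℝ) = Real.sqrt N * Real.sqrt N := (Real.mul_self_sqrt (by linarith)).symm
    -- combine: `(log μ + 6√N + log(2N+1))/N ≤ (177/20)√N/N = (177/20)/√N ≤ 30/√T`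
    have hnum : Real.log μ + 6 * Real.sqrt N + Real.log (2 * N + 1) ≤ 177 / 20 * Real.sqrt N := by
      nlinarith [hlog2N, hsN, hlogμ, hlogμ']
    have hstep : Real.log μ - Real.log (stripConnectiveConstant (4 * N)) ≤ 177 / 20 / Real.sqrt N := by
      refine hrate.trans ?_
      rw [div_le_div_iff₀ (by linarith) hsN0]
      calc (Real.log μ + 6 * Real.sqrt N + Real.log (2 * N + 1)) * Real.sqrt N
          ≤ (177 / 20 * Real.sqrt N) * Real.sqrt N := mul_le_mul_of_nonneg_right hnum hsN0.le
        _ = 177 / 20 * (Real.sqrt N * Real.sqrt N) := by ring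
        _ = 177 / 20 * N := by rw [← hNsq]
    have hfin : 177 / 20 / Real.sqrt N ≤ 30 / Real.sqrt T := by
      rw [div_le_div_iff₀ hsN0 hsT0]
      calc 177 / 20 * Real.sqrt T ≤ 177 / 20 * (10 / 3 * Real.sqrt N) :=
            mul_le_mul_of_nonneg_left hsTN (by norm_num)
        _ ≤ 30 * Real.sqrt N := by nlinarith [hsN0]
    linarith

/-- The same with the constant packaged existentially: `∃ C, ∀ T ≥ 1, 0 ≤ log μ_ℍ − log μ(S_T) ≤ C/√T`.
[cite: MadrasSlade1993, Theorem 8.2.1, eq. (8.2.12)] -/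
theorem exists_log_sub_log_stripConnectiveConstant_le :
    ∃ C : ℝ, ∀ T : ℕ, 1 ≤ T →
      0 ≤ Real.log hexConnectiveConstant - Real.log (stripConnectiveConstant T) ∧
      Real.log hexConnectiveConstant - Real.log (stripConnectiveConstant T) ≤ C / Real.sqrt T :=
  ⟨30, fun _ hT => log_sub_log_stripConnectiveConstant_le hT⟩

/-- The rate in multiplicative form: `μ_ℍ · e^{−30/√T} ≤ μ(S_T) ≤ μ_ℍ` for `T ≥ 1`.
[cite: MadrasSlade1993, Theorem 8.2.1, eq. (8.2.12)] -/
theorem mul_exp_neg_le_stripConnectiveConstant {T : ℕ} (hT : 1 ≤ T) :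
    hexConnectiveConstant * Real.exp (-(30 / Real.sqrt T)) ≤ stripConnectiveConstant T ∧
      stripConnectiveConstant T ≤ hexConnectiveConstant := by
  have hμ : 0 < hexConnectiveConstant := hexConnectiveConstant_pos
  have h := (log_sub_log_stripConnectiveConstant_le hT).2
  have hpos := stripConnectiveConstant_pos T
  refine ⟨?_, stripConnectiveConstant_le T⟩
  have : Real.log (hexConnectiveConstant * Real.exp (-(30 / Real.sqrt T))) ≤
      Real.log (stripConnectiveConstant T) := by
    rw [Real.log_mul hμ.ne' (Real.exp_pos _).ne', Real.log_exp]
    linarith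
  exact (Real.log_le_log_iff (by positivity) hpos).1 this

/-- **The deficit form**: `0 ≤ μ_ℍ − μ(S_T) ≤ 56/√T` for `T ≥ 1` (from `μ_ℍ e^{−30/√T} ≤ μ(S_T)`,
`1 − x ≤ e^{−x}` and `μ_ℍ ≤ 37/20`).  This is the quantity of the lane's strip-deficit numerics (P-HEXW′:
`(μ_ℍ − μ_T)(T+1)^{4/3} ≈ 2.305` in the Duminil-Copin–Smirnov frame), with the Hammersley–Welsh exponent `1/2`
in place of the conjectured `4/3`. [cite: MadrasSlade1993, Theorem 8.2.1 (8.2.12) and its proof, (8.2.14) (p. 269)] -/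
theorem sub_stripConnectiveConstant_le {T : ℕ} (hT : 1 ≤ T) :
    0 ≤ hexConnectiveConstant - stripConnectiveConstant T ∧
      hexConnectiveConstant - stripConnectiveConstant T ≤ 56 / Real.sqrt T := by
  obtain ⟨hlo, hhi⟩ := mul_exp_neg_le_stripConnectiveConstant hT
  refine ⟨by linarith, ?_⟩
  have hμ : 0 < hexConnectiveConstant := hexConnectiveConstant_pos
  have hμ' : hexConnectiveConstant ≤ 37 / 20 := hexConnectiveConstant_le.1
  have hsT0 : 0 < Real.sqrt T := Real.sqrt_pos.2 (by exact_mod_cast (show 0 < T by omega))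
  have hexp : 1 - 30 / Real.sqrt T ≤ Real.exp (-(30 / Real.sqrt T)) := by
    have := Real.add_one_le_exp (-(30 / Real.sqrt T))
    linarith
  have h1 : hexConnectiveConstant * (1 - 30 / Real.sqrt T) ≤ stripConnectiveConstant T :=
    (mul_le_mul_of_nonneg_left hexp hμ.le).trans hlo
  have h30 : 0 ≤ 30 / Real.sqrt T := by positivity
  rw [div_eq_mul_one_div (56 : ℝ), show (30 : ℝ) / Real.sqrt T = 30 * (1 / Real.sqrt T) by ring] at *
  nlinarith [h1, hμ', h30, hμ]

/-- **Madras–Slade Theorem 8.2.1 (8.2.12) on the honeycomb lattice**: `lim_{T→∞} μ(S_T) = μ_ℍ` — the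
connective constant of `ℍ` is the limit of the connective constants of its strips (locality).  For honeycomb strips
the qualitative limit (and the strict monotonicity in `T`) is printed: Beaton–Bousquet-Mélou–de Gier–Duminil-Copin–
Guttmann 2014, Proposition 7 at `y = 1` (after Janse van Rensburg–Orlandini–Whittington 2006); the rate of this file is not.
[cite: MadrasSlade1993, Theorem 8.2.1 (8.2.12) and its proof, (8.2.14) (p. 269); Corollary 3.1.6 (3.1.9) (p. 61); Notes §8.5 (Hammersley–Whittington 1985)]
[cite: BeatonBousquetMelouDeGierDuminilCopinGuttmann2014, Proposition 7 (y = 1), arXiv p. 11] [cite: Beaton2014RotatedHoneycomb, §3.2, Proposition 9 (arXiv v3 p. 15; rotated strips)]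
[cite: GrimmettLi2018Locality] -/
theorem tendsto_stripConnectiveConstant :
    Tendsto (fun T : ℕ => stripConnectiveConstant T) atTop (𝓝 hexConnectiveConstant) := by
  set μ := hexConnectiveConstant with hμdef
  have hμ : 0 < μ := hexConnectiveConstant_pos
  have hlim : Tendsto (fun T : ℕ => μ * Real.exp (-(30 / Real.sqrt T))) atTop (𝓝 μ) := by
    have h1 : Tendsto (fun T : ℕ => (30 : ℝ) / Real.sqrt (T : ℝ)) atTop (𝓝 0) := by
      have hs : Tendsto (fun T : ℕ => Real.sqrt (T : ℝ)) atTop atTop :=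
        Real.tendsto_sqrt_atTop.comp tendsto_natCast_atTop_atTop
      exact hs.const_div_atTop 30
    have h1' : Tendsto (fun T : ℕ => -((30 : ℝ) / Real.sqrt (T : ℝ))) atTop (𝓝 0) := by
      simpa using h1.neg
    have h2 : Tendsto (fun T : ℕ => Real.exp (-((30 : ℝ) / Real.sqrt (T : ℝ)))) atTop (𝓝 1) := by
      have := (Real.continuous_exp.tendsto 0).comp h1'
      rwa [Real.exp_zero] at this
    simpa using h2.const_mul μ
  refine tendsto_of_tendsto_of_tendsto_of_le_of_le' hlim tendsto_const_nhds ?_ ?_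
  · filter_upwards [eventually_ge_atTop 1] with T hT using (mul_exp_neg_le_stripConnectiveConstant hT).1
  · filter_upwards [eventually_ge_atTop 1] with T hT using (mul_exp_neg_le_stripConnectiveConstant hT).2

/-- **`μ(S_T) ↑ μ_ℍ`**: the strip constants increase to the connective constant of the honeycomb lattice,
`μ_ℍ = sup_T μ(S_T)` (printed, qualitatively, for honeycomb strips: BBdGDCG 2014 Proposition 7 at `y = 1`, together with
the STRICT inequality `μ_T < μ_{T+1}`, which is not proved here — only the weak `stripConnectiveConstant_mono`).
[cite: MadrasSlade1993, Theorem 8.2.1, eq. (8.2.12)] [cite: BeatonBousquetMelouDeGierDuminilCopinGuttmann2014, Proposition 7 (y = 1), arXiv p. 11] -/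
theorem iSup_stripConnectiveConstant : (⨆ T : ℕ, stripConnectiveConstant T) = hexConnectiveConstant := by
  have hbdd : BddAbove (Set.range stripConnectiveConstant) :=
    ⟨hexConnectiveConstant, by rintro _ ⟨T, rfl⟩; exact stripConnectiveConstant_le T⟩
  have hmono : Monotone stripConnectiveConstant := fun _ _ h => stripConnectiveConstant_mono h
  exact tendsto_nhds_unique (tendsto_atTop_ciSup hmono hbdd) tendsto_stripConnectiveConstant

/-! ### The asymptotic constant `12 = 2 · 6`: `log μ_ℍ − log μ(S_T) ≤ (12 + η)/√T` eventually -/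

/-- For `T ≥ 4` the bridge length used at width `T` is `N(T) := T/4 − (1 − (T/4) mod 2)`, the largest odd number
`≤ T/4`: it is odd, `≥ 1`, and `4 N(T) ≤ T ≤ 4 N(T) + 7`. [cite: MadrasSlade1993, §8.2, proof of Theorem 8.2.1] -/
private theorem oddQuarter_spec {T : ℕ} (hT : 4 ≤ T) :
    Odd (T / 4 - (1 - T / 4 % 2)) ∧ 1 ≤ T / 4 - (1 - T / 4 % 2) ∧ 4 * (T / 4 - (1 - T / 4 % 2)) ≤ T ∧
      T ≤ 4 * (T / 4 - (1 - T / 4 % 2)) + 7 := by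
  refine ⟨Nat.odd_iff.2 ?_, ?_, ?_, ?_⟩ <;> omega

/-- `N(T) → ∞`. [cite: MadrasSlade1993, §8.2, proof of Theorem 8.2.1] -/
private theorem tendsto_oddQuarter : Tendsto (fun T : ℕ => T / 4 - (1 - T / 4 % 2)) atTop atTop := by
  refine tendsto_atTop_atTop.2 fun b => ⟨4 * (b + 2), fun T hT => ?_⟩
  show b ≤ T / 4 - (1 - T / 4 % 2)
  omega

/-- `log N / √N → 0`. [folklore] -/
private theorem tendsto_log_div_sqrt : Tendsto (fun N : ℕ => Real.log N / Real.sqrt N) atTop (𝓝 0) := by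
  have h := (isLittleO_log_rpow_atTop (by norm_num : (0 : ℝ) < 1 / 2)).tendsto_div_nhds_zero
  refine (h.comp tendsto_natCast_atTop_atTop).congr fun N => ?_
  rw [Function.comp_apply, Real.sqrt_eq_rpow]

/-- The majorant `g(N) = ((17/20 + log 3 + log N)/√N + 6) · √(4 + 7/N)` of `N ↦ r(N) √(4N+7)` tends to `12`.
[cite: MadrasSlade1993, Theorem 8.2.1 (8.2.12) and its proof] -/
private theorem tendsto_majorant :
    Tendsto (fun N : ℕ => ((17 / 20 + Real.log 3 + Real.log N) / Real.sqrt N + 6) * Real.sqrt (4 + 7 / (N : ℝ)))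
      atTop (𝓝 12) := by
  have hs : Tendsto (fun N : ℕ => Real.sqrt (N : ℝ)) atTop atTop :=
    Real.tendsto_sqrt_atTop.comp tendsto_natCast_atTop_atTop
  have h1 : Tendsto (fun N : ℕ => (17 / 20 + Real.log 3) / Real.sqrt N) atTop (𝓝 0) := hs.const_div_atTop _
  have h2 : Tendsto (fun N : ℕ => (17 / 20 + Real.log 3 + Real.log N) / Real.sqrt N + 6) atTop (𝓝 (0 + 0 + 6)) := by
    refine ((h1.add tendsto_log_div_sqrt).add tendsto_const_nhds).congr fun N => ?_
    ring
  have h3 : Tendsto (fun N : ℕ => (4 : ℝ) + 7 / (N : ℝ)) atTop (𝓝 (4 + 0)) :=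
    tendsto_const_nhds.add (tendsto_const_div_atTop_nhds_zero_nat 7)
  have h4 : Tendsto (fun N : ℕ => Real.sqrt (4 + 7 / (N : ℝ))) atTop (𝓝 2) := by
    have := (Real.continuous_sqrt.tendsto _).comp h3
    rwa [add_zero, show Real.sqrt 4 = 2 by
      rw [show (4 : ℝ) = 2 ^ 2 by norm_num, Real.sqrt_sq (by norm_num)]] at this
  have := h2.mul h4
  norm_num at this
  exact this

/-- **The asymptotic constant `2 · 6 = 12`**: for every `η > 0`, eventually in `T`,
`log μ_ℍ − log μ(S_T) ≤ (12 + η)/√T` (the rate at width `4N`, `N` the largest odd number `≤ T/4`, with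
`T ≤ 4N + 7` and `log(2N+1)/√N → 0`). [cite: MadrasSlade1993, Theorem 8.2.1 (8.2.12) and its proof, (8.2.14) (p. 269); Corollary 3.1.6 (3.1.9) (p. 61)] -/
theorem log_sub_log_stripConnectiveConstant_le_eventually {η : ℝ} (hη : 0 < η) :
    ∀ᶠ T : ℕ in atTop,
      Real.log hexConnectiveConstant - Real.log (stripConnectiveConstant T) ≤ (12 + η) / Real.sqrt T := by
  have hev : ∀ᶠ N : ℕ in atTop,
      ((17 / 20 + Real.log 3 + Real.log N) / Real.sqrt N + 6) * Real.sqrt (4 + 7 / (N : ℝ)) ≤ 12 + η :=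
    tendsto_majorant.eventually (Iic_mem_nhds (by linarith))
  filter_upwards [tendsto_oddQuarter.eventually hev, eventually_ge_atTop 4] with T hT h4
  obtain ⟨hodd, hN1, h4N, hT7⟩ := oddQuarter_spec h4
  set N := T / 4 - (1 - T / 4 % 2) with hNdef
  set μ := hexConnectiveConstant with hμdef
  have hNr : (1 : ℝ) ≤ N := by exact_mod_cast hN1
  have hN0 : (0 : ℝ) < N := by linarith
  have hsN0 : 0 < Real.sqrt N := Real.sqrt_pos.2 hN0
  have hTr : (4 : ℝ) ≤ T := by exact_mod_cast h4
  have hsT0 : 0 < Real.sqrt T := Real.sqrt_pos.2 (by linarith)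
  -- `gap(T) ≤ gap(4N) ≤ r(N)`
  have hmono : Real.log (stripConnectiveConstant (4 * N)) ≤ Real.log (stripConnectiveConstant T) :=
    Real.log_le_log (stripConnectiveConstant_pos _) (stripConnectiveConstant_mono h4N)
  have hrate := log_sub_log_stripConnectiveConstant_four_mul_le hodd
  have hlogμ : Real.log μ ≤ 17 / 20 := log_hexConnectiveConstant_le
  have hlog2N : Real.log (2 * N + 1) ≤ Real.log 3 + Real.log N := by
    rw [← Real.log_mul (by norm_num) hN0.ne']
    exact Real.log_le_log (by linarith) (by linarith)
  -- `r(N) ≤ g(N)/√(4N+7)`: `√(4N+7) = √N √(4+7/N)` and `N = √N √N`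
  have hs47 : Real.sqrt (4 * N + 7) = Real.sqrt N * Real.sqrt (4 + 7 / (N : ℝ)) := by
    rw [← Real.sqrt_mul hN0.le]
    congr 1
    field_simp
  have hs47pos : 0 < Real.sqrt (4 * (N : ℝ) + 7) := Real.sqrt_pos.2 (by linarith)
  have hNsq : (N : ℝ) = Real.sqrt N * Real.sqrt N := (Real.mul_self_sqrt hN0.le).symm
  have hkey : (Real.log μ + 6 * Real.sqrt N + Real.log (2 * N + 1)) / N ≤
      ((17 / 20 + Real.log 3 + Real.log N) / Real.sqrt N + 6) * Real.sqrt (4 + 7 / (N : ℝ)) /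
        Real.sqrt (4 * N + 7) := by
    rw [hs47, mul_div_mul_comm, div_self (ne_of_gt (Real.sqrt_pos.2 (by positivity))), mul_one,
      div_add' _ _ _ hsN0.ne', div_div, ← hNsq]
    exact div_le_div_of_nonneg_right (by linarith) hN0.le
  -- `√T ≤ √(4N+7)`
  have hsT : Real.sqrt T ≤ Real.sqrt (4 * N + 7) := Real.sqrt_le_sqrt (by exact_mod_cast hT7)
  have hg0 : 0 ≤ ((17 / 20 + Real.log 3 + Real.log N) / Real.sqrt N + 6) * Real.sqrt (4 + 7 / (N : ℝ)) := by
    have : 0 ≤ Real.log 3 := Real.log_nonneg (by norm_num)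
    have : 0 ≤ Real.log N := Real.log_nonneg hNr
    positivity
  calc Real.log μ - Real.log (stripConnectiveConstant T)
      ≤ Real.log μ - Real.log (stripConnectiveConstant (4 * N)) := by linarith
    _ ≤ _ := hrate.trans hkey
    _ ≤ (12 + η) / Real.sqrt (4 * N + 7) := div_le_div_of_nonneg_right hT hs47pos.le
    _ ≤ (12 + η) / Real.sqrt T := div_le_div_of_nonneg_left (by linarith) hsT0 hsT

end Literature.Probability.RandomPlanarGeometry.SAW.HexBW
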